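import Literature.Analysis.Calculus.ParametricSliceJets          -- ★ `fderiv_integral_comp_of_contDiff_of_support_apply`, `fderiv_apply_eq_zero_of_forall_eq_zero`
import Literature.Analysis.Calculus.DirDerivOpenCommute           -- ★ `dirDeriv_eqOn_of_eqOn`, `contDiffOn_dirDeriv`, `dirDeriv_comm_eqOn`
import Literature.Analysis.Calculus.IteratedFDerivNestedPartials  -- ★ `exists_forall_norm_iteratedFDeriv_le_of_foldr_fderiv_basis`, `iteratedFDeriv_apply_eq_foldr_fderiv`
import Literature.Analysis.Calculus.ContDiffCurryCompact          -- ★ (CURRY-∞) `contDiff_curry_of_contDiff`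
import HarnessLib

/-!
# Jets of a parametric orbital family `Ψ(θ, q) = r(θ) • ∫ Θ(q, κ_y(θ)) dμ(y)` from an ENGINE bounding the `θ`-jets uniformly over test functions `ℓ ∘ G`
# (Hörmander, *ALPDO I* §1.1; Harish-Chandra ∕ Warner II Thm. 8.4.3.1 as the engine; Bouaziz 1994 §3.1 (I₁))

Topic `Analysis/Calculus`; namespace `Literature.Analysis.Calculus`.  THEOREMS ONLY (no `def`, no instance, no notation, no axiom, no `sorry`); generic calculus for the
(I₁) jet bounds of the archimedean orbital families at SCALAR CORNERS ((B3-JUNCTION), crux H413 `stmt-HodgeConjecture-24833`, cell `pub/hodgecm-mathlib`, LH3 leaf v5 organ O-L1d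
socket `hC₀`): the normal variable `θ` is MULTI-dimensional (`V₁`, e.g. `Fin 3 → ℝ`), so the one-dimensional reader calculus of ★ `IteratedFDerivParamWords` ∕ (X3) does not apply.

THE MATHEMATICS.  Let `Ψ : V₁ × P → F` be `C^∞` on an open product `Sθ × O` and have there the INTEGRAL FORM `Ψ(θ, q) = r(θ) • ∫_Y Θ(q, κ_y(θ)) dμ(y)` with `Θ : P × M → F` smooth,
`Θ(q, ·)` vanishing off ONE set `C_X ⊆ M` for all `q`, and the datum `y ↦ κ_y(θ)` continuous and PROPER relative to `C_X` at every `θ ∈ Sθ` (`{y ∣ κ_y(θ) ∈ C_X}` inside a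
compact).  Suppose an ENGINE bounds, for every smooth `G : M → E′` vanishing off `C_X` (here `E′ = C(K, F)` for a compact `K ⊆ O`) and every order `a`, the `θ`-jets of
`θ ↦ r(θ) • ∫ ℓ(G(κ_y θ)) dμ` on a region `Sθ′ ⊆ Sθ` by `‖ℓ‖ · M` UNIFORMLY in `ℓ : E′ →L F` (Harish-Chandra's theorem in the seminorm form of ★ (B3-ENGINE) §6).  THEN every joint
jet `‖Dⁿ Ψ(θ, q)‖` is bounded on `Sθ′ × K`.  Proof: by ★ (B2b) it suffices to bound the nested partials along basis words of `V₁ × P`; a `q`-letter `∂_{(0,v)}` passes under the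
integral (uniform compact support at fixed regular `θ`, ★ `fderiv_integral_comp_of_contDiff_of_support_apply`) and replaces `Θ` by `∂_v Θ` (same class), and commutes past the
`θ`-letters already applied (Schwarz on the open set, ★ `dirDeriv_comm_eqOn`); so every word reduces ON `Sθ × O` to `θ`-letters applied to a family of the same form, i.e. to
`θ`-derivatives of the SLICE `θ ↦ r θ • ∫ Θ′(q, κ_y θ) dμ = r θ • ∫ ev_q (G(κ_y θ)) dμ` with `G` the `C(K, F)`-valued curried family (★ (CURRY-∞)) — which the engine bounds by
`‖ev_q‖ · M ≤ M`, uniformly in `q ∈ K`.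

* §1 slices: `fderiv_apply_inl_zero_eq_fderiv_slice_fst`, `fderiv_apply_zero_inr_eq_fderiv_slice_snd`.
* §2 the `q`-letter: **`fderiv_smul_integral_family_apply_inr`** (`∂_{(0,v)} Ψ = r θ • ∫ ∂_v Θ`), `contDiff_fderiv_family_inl`, `fderiv_family_inl_eq_zero_of_support`.
* §3 the `θ`-letters: `contDiffOn_foldr_fderiv_inl`, `foldr_fderiv_inl_eq_foldr_slice`, `fderiv_inr_foldr_fderiv_inl_eqOn` (Schwarz past a `θ`-word).
* §4 the reduction of an arbitrary basis word and the HEAD **`exists_forall_norm_iteratedFDeriv_le_of_smul_integral_family`**.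

## References
* [HormanderALPDO1] L. Hörmander, *The Analysis of Linear Partial Differential Operators I* (1983), §1.1 Thms. 1.1.6, 1.1.8, 1.1.9 (pp. 7–12).
* [WarnerHASSLG2] G. Warner, *Harmonic Analysis on Semi-Simple Lie Groups II* (1972), Thm. 8.4.3.1.
* [Bouaziz1994IntegralesOrbitales] A. Bouaziz, *Intégrales orbitales sur les groupes de Lie réductifs*, Ann. Sci. ÉNS 27 (1994), §3.1 (I₁) p. 579.
* [Coleman2012] R. Coleman, *Calculus on Normed Vector Spaces*, Universitext (2012), §4.5.
-/

set_option autoImplicit false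

noncomputable section

open MeasureTheory Set Filter Topology Function Metric BoundedContinuousFunction
open scoped ContDiff

namespace Literature.Analysis.Calculus

/-! ## §1 Partial derivatives of a jointly differentiable function are derivatives of its slices -/

section Slices

variable {V₁ : Type*} [NormedAddCommGroup V₁] [NormedSpace ℝ V₁] {P : Type*} [NormedAddCommGroup P] [NormedSpace ℝ P]
  {F : Type*} [NormedAddCommGroup F] [NormedSpace ℝ F]

/-- `∂_{(u,0)} f(θ, q) = ∂_u [f(·, q)](θ)` at a point of (joint) differentiability. [cite: HormanderALPDO1, §1.1 (1.1.3)] -/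
theorem fderiv_apply_inl_zero_eq_fderiv_slice_fst {f : V₁ × P → F} {z : V₁ × P} (hf : DifferentiableAt ℝ f z) (u : V₁) :
    fderiv ℝ f z (u, 0) = fderiv ℝ (fun θ : V₁ => f (θ, z.2)) z.1 u := by
  have h := (hf.hasFDerivAt.comp z.1 (hasFDerivAt_prodMk_left (𝕜 := ℝ) z.1 z.2)).fderiv
  rw [show (fun θ : V₁ => f (θ, z.2)) = f ∘ (fun θ : V₁ => (θ, z.2)) from rfl, h]
  rfl

/-- `∂_{(0,v)} f(θ, q) = ∂_v [f(θ, ·)](q)` at a point of (joint) differentiability. [cite: HormanderALPDO1, §1.1 (1.1.3)] -/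
theorem fderiv_apply_zero_inr_eq_fderiv_slice_snd {f : V₁ × P → F} {z : V₁ × P} (hf : DifferentiableAt ℝ f z) (v : P) :
    fderiv ℝ f z (0, v) = fderiv ℝ (fun q : P => f (z.1, q)) z.2 v := by
  have h := (hf.hasFDerivAt.comp z.2 (hasFDerivAt_prodMk_right (𝕜 := ℝ) z.1 z.2)).fderiv
  rw [show (fun q : P => f (z.1, q)) = f ∘ (fun q : P => (z.1, q)) from rfl, h]
  rfl

end Slices

/-! ## §2 The `q`-letter: a transversal derivative passes under the integral and replaces `Θ` by `∂_v Θ` -/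

section QLetter

variable {V₁ : Type*} [NormedAddCommGroup V₁] [NormedSpace ℝ V₁]
  {P : Type*} [NormedAddCommGroup P] [NormedSpace ℝ P] [FiniteDimensional ℝ P]
  {M : Type*} [NormedAddCommGroup M] [NormedSpace ℝ M]
  {F : Type*} [NormedAddCommGroup F] [NormedSpace ℝ F]
  {Y : Type*} [TopologicalSpace Y] [T2Space Y] [MeasurableSpace Y] [OpensMeasurableSpace Y]

omit [FiniteDimensional ℝ P] in
/-- The partial `q`-derivative of a jointly smooth `Θ : P × M → F` in the direction `v`, read as `∂_{(v,0)} Θ`, is the derivative of the slice `q ↦ Θ(q, X)`.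
[cite: HormanderALPDO1, §1.1 (1.1.3)] -/
theorem fderiv_family_inl_eq_fderiv_slice {Θ : P × M → F} (hΘ : ContDiff ℝ ∞ Θ) (q : P) (X : M) (v : P) :
    fderiv ℝ Θ (q, X) (v, 0) = fderiv ℝ (fun q' : P => Θ (q', X)) q v :=
  fderiv_apply_inl_zero_eq_fderiv_slice_fst ((hΘ.differentiable (by simp)) (q, X)) v

omit [FiniteDimensional ℝ P] in
/-- **`∂_v Θ` is again jointly smooth.** [cite: HormanderALPDO1, §1.1 Thm. 1.1.6] -/
theorem contDiff_fderiv_family_inl {Θ : P × M → F} (hΘ : ContDiff ℝ ∞ Θ) (v : P) :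
    ContDiff ℝ ∞ (fun p : P × M => fderiv ℝ Θ p (v, 0)) :=
  ((contDiff_infty_iff_fderiv.1 hΘ).2).clm_apply contDiff_const

omit [FiniteDimensional ℝ P] in
/-- **`∂_v Θ` vanishes off the same set `C_X`** as `Θ` (uniformly in the parameter). [cite: HormanderALPDO1, §1.1 Thm. 1.1.9] -/
theorem fderiv_family_inl_eq_zero_of_support {Θ : P × M → F} (hΘ : ContDiff ℝ ∞ Θ) {C_X : Set M} (h0 : ∀ (q : P) (X : M), X ∉ C_X → Θ (q, X) = 0) (v : P) :
    ∀ (q : P) (X : M), X ∉ C_X → fderiv ℝ Θ (q, X) (v, 0) = 0 := fun q X hX => by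
  rw [fderiv_family_inl_eq_fderiv_slice hΘ q X v]
  exact fderiv_apply_eq_zero_of_forall_eq_zero (Θ := fun q' X => Θ (q', X)) (fun q' => h0 q' X hX) q v

/-- **THE `q`-LETTER.**  `Ψ(θ, q) := r(θ) • ∫ Θ(q, κ_y θ) dμ(y)` with `Θ` smooth vanishing off `C_X` for all `q`, `y ↦ κ_y θ` continuous and `{y ∣ κ_y θ ∈ C_X}` inside a compact `C`
(at THIS `θ`): if `Ψ` is (jointly) differentiable at `z = (θ, q)` then **`∂_{(0,v)} Ψ(z) = r(θ) • ∫ ∂_{(v,0)} Θ(q, κ_y θ) dμ(y)`** (Hörmander's differentiation under the integral with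
uniform compact support, ★ `fderiv_integral_comp_of_contDiff_of_support_apply`). [cite: HormanderALPDO1, Thm. 1.1.9] -/
theorem fderiv_smul_integral_family_apply_inr (μ : Measure Y) [IsFiniteMeasureOnCompacts μ] (r : V₁ → ℝ) (κ : Y → V₁ → M)
    {Θ : P × M → F} (hΘ : ContDiff ℝ ∞ Θ) {C_X : Set M} (h0 : ∀ (q : P) (X : M), X ∉ C_X → Θ (q, X) = 0)
    {z : V₁ × P} (hκ : Continuous fun y => κ y z.1) {C : Set Y} (hC : IsCompact C) (hprop : ∀ y, κ y z.1 ∈ C_X → y ∈ C)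
    (hdiff : DifferentiableAt ℝ (fun z : V₁ × P => r z.1 • ∫ y, Θ (z.2, κ y z.1) ∂μ) z) (v : P) :
    fderiv ℝ (fun z : V₁ × P => r z.1 • ∫ y, Θ (z.2, κ y z.1) ∂μ) z (0, v) = r z.1 • ∫ y, fderiv ℝ Θ (z.2, κ y z.1) (v, 0) ∂μ := by
  rw [fderiv_apply_zero_inr_eq_fderiv_slice_snd hdiff v]
  dsimp only
  -- the integrand family in Hörmander's shape: `Ψ′ (datum, variable) = Θ (variable, datum)`
  have hΨ' : ContDiff ℝ ∞ (fun p : M × P => Θ (p.2, p.1)) := hΘ.comp (contDiff_snd.prodMk contDiff_fst)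
  have hsupp : ∀ t ∉ C, ∀ X ∈ (Set.univ : Set P), (fun p : M × P => Θ (p.2, p.1)) (κ t z.1, X) = 0 :=
    fun t ht X _ => h0 X _ (fun h => ht (hprop t h))
  have hD := hasFDerivAt_integral_comp_of_contDiff_of_support μ (fun p : M × P => Θ (p.2, p.1)) hΨ' (fun y => κ y z.1) hκ z.2 hC Filter.univ_mem hsupp
  have happ := fderiv_integral_comp_of_contDiff_of_support_apply μ (fun p : M × P => Θ (p.2, p.1)) hΨ' (fun y => κ y z.1) hκ z.2 hC Filter.univ_mem hsupp v
  dsimp only at hD happ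
  have heq : (fun q : P => r z.1 • ∫ y, Θ (q, κ y z.1) ∂μ) = r z.1 • (fun q : P => ∫ y, Θ (q, κ y z.1) ∂μ) := rfl
  rw [heq, fderiv_const_smul hD.differentiableAt, _root_.smul_apply, happ]
  congr 1
  refine integral_congr_ae (Filter.Eventually.of_forall fun y => ?_)
  exact (fderiv_family_inl_eq_fderiv_slice hΘ z.2 (κ y z.1) v).symm

end QLetter

/-! ## §3 The `θ`-letters: words of `∂_{(u,0)}`'s are words of the slice, and `∂_{(0,v)}` commutes past them (Schwarz) -/

section ThetaLetters

variable {V : Type*} [NormedAddCommGroup V] [NormedSpace ℝ V]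
  {V₁ : Type*} [NormedAddCommGroup V₁] [NormedSpace ℝ V₁] {P : Type*} [NormedAddCommGroup P] [NormedSpace ℝ P]
  {F : Type*} [NormedAddCommGroup F] [NormedSpace ℝ F]

/-- **Locality of a word of directional derivatives**: if `g₁ = g₂` on the open `U` then every nested word `D_{m 0} ⋯ D_{m (a-1)}` of them agrees on `U`.
[cite: HormanderALPDO1, §1.1 pp. 7–12] -/
theorem foldr_fderiv_eqOn_of_eqOn {U : Set V} (hU : IsOpen U) (a : ℕ) :
    ∀ (m : Fin a → V) {g₁ g₂ : V → F}, EqOn g₁ g₂ U →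
      EqOn (Fin.foldr a (fun k (g : V → F) => fun y => fderiv ℝ g y (m k)) g₁) (Fin.foldr a (fun k (g : V → F) => fun y => fderiv ℝ g y (m k)) g₂) U := by
  induction a with
  | zero => intro m g₁ g₂ h; simpa using h
  | succ a ih =>
    intro m g₁ g₂ h
    rw [Fin.foldr_succ, Fin.foldr_succ]
    exact dirDeriv_eqOn_of_eqOn hU (ih (fun k => m k.succ) h) (m 0)

/-- **A word of directional derivatives of a `C^∞` function on an open set is `C^∞` there.** [cite: HormanderALPDO1, §1.1 pp. 7–12] -/
theorem contDiffOn_foldr_fderiv {U : Set V} (hU : IsOpen U) (a : ℕ) :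
    ∀ (m : Fin a → V) {g : V → F}, ContDiffOn ℝ ∞ g U → ContDiffOn ℝ ∞ (Fin.foldr a (fun k (g : V → F) => fun y => fderiv ℝ g y (m k)) g) U := by
  induction a with
  | zero => intro m g hg; simpa using hg
  | succ a ih =>
    intro m g hg
    rw [Fin.foldr_succ]
    exact contDiffOn_dirDeriv hU (ih (fun k => m k.succ) hg) (m 0)

/-- **`θ`-WORDS OF THE JOINT FUNCTION ARE `θ`-WORDS OF THE SLICE**: for `f` `C^∞` on the open `W ⊆ V₁ × P` and `z = (θ, q) ∈ W`,
`(D_{(u₀,0)} ⋯ D_{(u_{a-1},0)} f)(θ, q) = (D_{u₀} ⋯ D_{u_{a-1}} f(·, q))(θ)`. [cite: HormanderALPDO1, §1.1 (1.1.3), Thm. 1.1.8] -/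
theorem foldr_fderiv_inl_eq_foldr_slice {W : Set (V₁ × P)} (hW : IsOpen W) (a : ℕ) :
    ∀ (u : Fin a → V₁) {f : V₁ × P → F}, ContDiffOn ℝ ∞ f W → ∀ {z : V₁ × P}, z ∈ W →
      Fin.foldr a (fun k (g : V₁ × P → F) => fun z => fderiv ℝ g z (u k, 0)) f z =
        Fin.foldr a (fun k (g : V₁ → F) => fun θ => fderiv ℝ g θ (u k)) (fun θ => f (θ, z.2)) z.1 := by
  induction a with
  | zero => intro u f _ z _; simp
  | succ a ih =>
    intro u f hf z hz
    rw [Fin.foldr_succ, Fin.foldr_succ]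
    have hT : ContDiffOn ℝ ∞ (Fin.foldr a (fun k (g : V₁ × P → F) => fun z => fderiv ℝ g z (u k.succ, 0)) f) W :=
      contDiffOn_foldr_fderiv hW a (fun k => (u k.succ, (0 : P))) hf
    have hd : DifferentiableAt ℝ (Fin.foldr a (fun k (g : V₁ × P → F) => fun z => fderiv ℝ g z (u k.succ, 0)) f) z :=
      (hT.contDiffAt (hW.mem_nhds hz)).differentiableAt (by simp)
    show fderiv ℝ (Fin.foldr a (fun k (g : V₁ × P → F) => fun z => fderiv ℝ g z (u k.succ, 0)) f) z (u 0, 0) =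
      fderiv ℝ (Fin.foldr a (fun k (g : V₁ → F) => fun θ => fderiv ℝ g θ (u k.succ)) (fun θ => f (θ, z.2))) z.1 (u 0)
    rw [fderiv_apply_inl_zero_eq_fderiv_slice_fst hd (u 0)]
    have hopen : IsOpen {θ : V₁ | (θ, z.2) ∈ W} := hW.preimage (continuous_id.prodMk continuous_const)
    have hzθ : z.1 ∈ {θ : V₁ | (θ, z.2) ∈ W} := by simpa using hz
    have hev : (fun θ : V₁ => Fin.foldr a (fun k (g : V₁ × P → F) => fun z => fderiv ℝ g z (u k.succ, 0)) f (θ, z.2)) =ᶠ[𝓝 z.1]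
        Fin.foldr a (fun k (g : V₁ → F) => fun θ => fderiv ℝ g θ (u k.succ)) (fun θ => f (θ, z.2)) := by
      filter_upwards [hopen.mem_nhds hzθ] with θ hθ
      exact ih (fun k => u k.succ) hf hθ
    rw [hev.fderiv_eq]

/-- **`∂_{(0,v)}` COMMUTES PAST A `θ`-WORD** on an open set (Schwarz, ★ `dirDeriv_comm_eqOn`):
`D_{(0,v)} (D_{(u₀,0)} ⋯ D_{(u_{a-1},0)} g) = D_{(u₀,0)} ⋯ D_{(u_{a-1},0)} (D_{(0,v)} g)` on `W` for `g` `C^∞` on `W`. [cite: HormanderALPDO1, §1.1 Thm. 1.1.8] -/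
theorem fderiv_inr_foldr_fderiv_inl_eqOn {W : Set (V₁ × P)} (hW : IsOpen W) (v : P) (a : ℕ) :
    ∀ (u : Fin a → V₁) {g : V₁ × P → F}, ContDiffOn ℝ ∞ g W →
      EqOn (fun z => fderiv ℝ (Fin.foldr a (fun k (h : V₁ × P → F) => fun z => fderiv ℝ h z (u k, 0)) g) z (0, v))
        (Fin.foldr a (fun k (h : V₁ × P → F) => fun z => fderiv ℝ h z (u k, 0)) (fun z => fderiv ℝ g z (0, v))) W := by
  induction a with
  | zero => intro u g _ z _; simp
  | succ a ih =>
    intro u g hg z hz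
    have hT : ContDiffOn ℝ ∞ (Fin.foldr a (fun k (h : V₁ × P → F) => fun z => fderiv ℝ h z (u k.succ, 0)) g) W :=
      contDiffOn_foldr_fderiv hW a (fun k => (u k.succ, (0 : P))) hg
    have h1 := dirDeriv_comm_eqOn hW hT (0, v) (u 0, 0) hz
    have h2 : EqOn (fun z => fderiv ℝ (Fin.foldr a (fun k (h : V₁ × P → F) => fun z => fderiv ℝ h z (u k.succ, 0)) g) z (0, v))
        (Fin.foldr a (fun k (h : V₁ × P → F) => fun z => fderiv ℝ h z (u k.succ, 0)) (fun z => fderiv ℝ g z (0, v))) W := ih (fun k => u k.succ) hg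
    show fderiv ℝ (Fin.foldr (a + 1) (fun k (h : V₁ × P → F) => fun z => fderiv ℝ h z (u k, 0)) g) z (0, v) =
      Fin.foldr (a + 1) (fun k (h : V₁ × P → F) => fun z => fderiv ℝ h z (u k, 0)) (fun z => fderiv ℝ g z (0, v)) z
    rw [Fin.foldr_succ, Fin.foldr_succ]
    exact h1.trans (dirDeriv_eqOn_of_eqOn hW h2 (u 0, 0) hz)

end ThetaLetters

/-! ## §4 Reduction of every basis word, and the head -/

section Head

variable {V₁ : Type*} [NormedAddCommGroup V₁] [NormedSpace ℝ V₁]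
  {P : Type*} [NormedAddCommGroup P] [NormedSpace ℝ P] [FiniteDimensional ℝ P]
  {M : Type*} [NormedAddCommGroup M] [NormedSpace ℝ M]
  {F : Type*} [NormedAddCommGroup F] [NormedSpace ℝ F]
  {Y : Type*} [TopologicalSpace Y] [T2Space Y] [MeasurableSpace Y] [OpensMeasurableSpace Y]

/-- **REDUCTION OF A BASIS WORD.**  On the open product `Sθ × O`, every nested word of partial derivatives of `Ψ = r • ∫ Θ(q, κ_y θ) dμ` along the product basis
`(b₁ i, 0)`, `(0, b₂ j)` EQUALS a word of `θ`-letters ONLY applied to a family of the same form `r • ∫ Θ′(q, κ_y θ) dμ`, `Θ′` a nested `q`-partial of `Θ` (smooth, vanishing off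
the same `C_X`): the `q`-letters pass under the integral (§2) and past the `θ`-letters (§3, Schwarz). [cite: HormanderALPDO1, §1.1 Thms. 1.1.8, 1.1.9] -/
theorem exists_word_reduction_smul_integral_family (μ : Measure Y) [IsFiniteMeasureOnCompacts μ] (r : V₁ → ℝ) (κ : Y → V₁ → M)
    {Sθ : Set V₁} (hSθ : IsOpen Sθ) {O : Set P} (hO : IsOpen O)
    {Θ : P × M → F} (hΘ : ContDiff ℝ ∞ Θ) {C_X : Set M} (h0 : ∀ (q : P) (X : M), X ∉ C_X → Θ (q, X) = 0)
    (hκ : ∀ θ ∈ Sθ, Continuous fun y => κ y θ) (hprop : ∀ θ ∈ Sθ, ∃ C : Set Y, IsCompact C ∧ ∀ y, κ y θ ∈ C_X → y ∈ C)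
    {Ψ : V₁ × P → F} (hΨ : ContDiffOn ℝ ∞ Ψ (Sθ ×ˢ O)) (hrep : ∀ z ∈ Sθ ×ˢ O, Ψ z = r z.1 • ∫ y, Θ (z.2, κ y z.1) ∂μ)
    {ι₁ ι₂ : Type*} (b₁ : Module.Basis ι₁ ℝ V₁) (b₂ : Module.Basis ι₂ ℝ P) {n : ℕ} (I : Fin n → ι₁ ⊕ ι₂) :
    ∃ (a : ℕ) (u : Fin a → ι₁) (Θ' : P × M → F), a ≤ n ∧ ContDiff ℝ ∞ Θ' ∧ (∀ (q : P) (X : M), X ∉ C_X → Θ' (q, X) = 0) ∧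
      ContDiffOn ℝ ∞ (fun z : V₁ × P => r z.1 • ∫ y, Θ' (z.2, κ y z.1) ∂μ) (Sθ ×ˢ O) ∧
      EqOn (Fin.foldr n (fun k (g : V₁ × P → F) => fun z => fderiv ℝ g z ((b₁.prod b₂) (I k))) Ψ)
        (Fin.foldr a (fun k (g : V₁ × P → F) => fun z => fderiv ℝ g z (b₁ (u k), 0)) (fun z : V₁ × P => r z.1 • ∫ y, Θ' (z.2, κ y z.1) ∂μ)) (Sθ ×ˢ O) := by
  have hW : IsOpen (Sθ ×ˢ O) := hSθ.prod hO
  induction n with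
  | zero =>
    refine ⟨0, Fin.elim0, Θ, le_rfl, hΘ, h0, hΨ.congr fun z hz => (hrep z hz).symm, fun z hz => ?_⟩
    simpa using hrep z hz
  | succ n ih =>
    obtain ⟨a, u, Θ', ha, hΘ', h0', hfam, hEq⟩ := ih (fun k => I k.succ)
    -- peel the outermost letter `I 0`
    have hstep : EqOn (Fin.foldr (n + 1) (fun k (g : V₁ × P → F) => fun z => fderiv ℝ g z ((b₁.prod b₂) (I k))) Ψ)
        (fun z => fderiv ℝ (Fin.foldr a (fun k (g : V₁ × P → F) => fun z => fderiv ℝ g z (b₁ (u k), 0)) (fun z : V₁ × P => r z.1 • ∫ y, Θ' (z.2, κ y z.1) ∂μ))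
          z ((b₁.prod b₂) (I 0))) (Sθ ×ˢ O) := by
      rw [Fin.foldr_succ]
      exact dirDeriv_eqOn_of_eqOn hW hEq _
    rcases hI : I 0 with i | j
    · -- a `θ`-letter: `(b₁ i, 0)`
      have hb : (b₁.prod b₂) (I 0) = (b₁ i, 0) := by
        rw [hI]; exact Prod.ext (Module.Basis.prod_apply_inl_fst b₁ b₂ i) (Module.Basis.prod_apply_inl_snd b₁ b₂ i)
      refine ⟨a + 1, Fin.cons i u, Θ', Nat.succ_le_succ ha, hΘ', h0', hfam, fun z hz => ?_⟩
      rw [hstep hz, hb, Fin.foldr_succ]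
      simp only [Fin.cons_zero, Fin.cons_succ]
    · -- a `q`-letter: `(0, b₂ j)` — Schwarz past the `θ`-word, then under the integral
      have hb : (b₁.prod b₂) (I 0) = (0, b₂ j) := by
        rw [hI]; exact Prod.ext (Module.Basis.prod_apply_inr_fst b₁ b₂ j) (Module.Basis.prod_apply_inr_snd b₁ b₂ j)
      have hcomm := fderiv_inr_foldr_fderiv_inl_eqOn hW (b₂ j) a (fun k => b₁ (u k)) hfam
      -- the `q`-derivative of the family is the family of `∂_{b₂ j} Θ′` on `Sθ × O`
      have hq : EqOn (fun z : V₁ × P => fderiv ℝ (fun z : V₁ × P => r z.1 • ∫ y, Θ' (z.2, κ y z.1) ∂μ) z (0, b₂ j))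
          (fun z : V₁ × P => r z.1 • ∫ y, (fun p : P × M => fderiv ℝ Θ' p (b₂ j, 0)) (z.2, κ y z.1) ∂μ) (Sθ ×ˢ O) := by
        intro z hz
        obtain ⟨C, hC, hpr⟩ := hprop z.1 hz.1
        exact fderiv_smul_integral_family_apply_inr μ r κ hΘ' h0' (hκ z.1 hz.1) hC hpr
          ((hfam.contDiffAt (hW.mem_nhds hz)).differentiableAt (by simp)) (b₂ j)
      refine ⟨a, u, fun p : P × M => fderiv ℝ Θ' p (b₂ j, 0), ha.trans (Nat.le_succ n), contDiff_fderiv_family_inl hΘ' (b₂ j),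
        fderiv_family_inl_eq_zero_of_support hΘ' h0' (b₂ j), (contDiffOn_dirDeriv hW hfam (0, b₂ j)).congr fun z hz => (hq hz).symm, fun z hz => ?_⟩
      rw [hstep hz, hb, hcomm hz]
      exact foldr_fderiv_eqOn_of_eqOn hW a (fun k => (b₁ (u k), (0 : P))) hq hz

variable [FiniteDimensional ℝ V₁]

/-- **HEAD — JOINT JET BOUNDS OF A PARAMETRIC ORBITAL FAMILY FROM A `θ`-ENGINE UNIFORM OVER `ℓ ∘ G`.**  `Ψ : V₁ × P → F` is `C^∞` on the open `Sθ × O` with the integral form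
`Ψ(θ, q) = r(θ) • ∫ Θ(q, κ_y θ) dμ(y)` there (`Θ` smooth, vanishing off `C_X` for every `q`; `y ↦ κ_y θ` continuous and proper relative to `C_X` at each `θ ∈ Sθ`); the ENGINE `hEng`
bounds on `Sθ′ ⊆ Sθ`, for every smooth `G : M → C(K, F)` vanishing off `C_X` and every order `a`, the `θ`-jets of `θ ↦ r θ • ∫ ℓ(G(κ_y θ)) dμ` by `‖ℓ‖ · M` uniformly in
`ℓ : C(K, F) →L F` (`K ⊆ O` compact).  THEN **for every `n`, `‖Dⁿ Ψ‖` is bounded on `Sθ′ × K`**: the (I₁) jet bound at a scalar corner, jointly in the transversal parameters.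
[cite: HormanderALPDO1, §1.1 Thms. 1.1.8, 1.1.9] [cite: WarnerHASSLG2, Thm. 8.4.3.1] [cite: Bouaziz1994IntegralesOrbitales, §3.1 (I₁) p. 579] -/
theorem exists_forall_norm_iteratedFDeriv_le_of_smul_integral_family (μ : Measure Y) [IsFiniteMeasureOnCompacts μ] (r : V₁ → ℝ) (κ : Y → V₁ → M)
    {Sθ Sθ' : Set V₁} (hSθ : IsOpen Sθ) (hS' : Sθ' ⊆ Sθ) {O K : Set P} (hO : IsOpen O) (hK : IsCompact K) (hKO : K ⊆ O)
    {Θ : P × M → F} (hΘ : ContDiff ℝ ∞ Θ) {C_X : Set M} (h0 : ∀ (q : P) (X : M), X ∉ C_X → Θ (q, X) = 0)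
    (hκ : ∀ θ ∈ Sθ, Continuous fun y => κ y θ) (hprop : ∀ θ ∈ Sθ, ∃ C : Set Y, IsCompact C ∧ ∀ y, κ y θ ∈ C_X → y ∈ C)
    {Ψ : V₁ × P → F} (hΨ : ContDiffOn ℝ ∞ Ψ (Sθ ×ˢ O)) (hrep : ∀ z ∈ Sθ ×ˢ O, Ψ z = r z.1 • ∫ y, Θ (z.2, κ y z.1) ∂μ)
    (hEng : ∀ G : M → (↥K →ᵇ F), ContDiff ℝ ∞ G → (∀ X, X ∉ C_X → G X = 0) → ∀ a : ℕ, ∃ Mb : ℝ, ∀ θ ∈ Sθ', ∀ ℓ : (↥K →ᵇ F) →L[ℝ] F,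
      ‖iteratedFDeriv ℝ a (fun θ : V₁ => r θ • ∫ y, ℓ (G (κ y θ)) ∂μ) θ‖ ≤ ‖ℓ‖ * Mb)
    (n : ℕ) : ∃ B : ℝ, ∀ z ∈ Sθ' ×ˢ K, ‖iteratedFDeriv ℝ n Ψ z‖ ≤ B := by
  haveI : CompactSpace ↥K := isCompact_iff_compactSpace.1 hK
  have hW : IsOpen (Sθ ×ˢ O) := hSθ.prod hO
  have hAW : Sθ' ×ˢ K ⊆ Sθ ×ˢ O := prod_mono hS' hKO
  refine exists_forall_norm_iteratedFDeriv_le_of_foldr_fderiv_basis ((Module.finBasis ℝ V₁).prod (Module.finBasis ℝ P)) hW hAW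
    (hΨ.of_le (by exact_mod_cast le_top)) fun I => ?_
  obtain ⟨a, u, Θ', -, hΘ', h0', hfam, hEq⟩ :=
    exists_word_reduction_smul_integral_family μ r κ hSθ hO hΘ h0 hκ hprop hΨ hrep (Module.finBasis ℝ V₁) (Module.finBasis ℝ P) I
  -- the `C(K, F)`-valued curried family of `Θ′` (★ CURRY-∞) and the engine's bound
  obtain ⟨G, hGdef⟩ : ∃ G : M → (↥K →ᵇ F), ∀ X (p : ↥K), G X p = Θ' ((p : P), X) :=
    ⟨fun X => BoundedContinuousFunction.mkOfCompact ⟨fun p : ↥K => Θ' ((p : P), X),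
      hΘ'.continuous.comp ((continuous_subtype_val).prodMk continuous_const)⟩, fun X p => rfl⟩
  have hG : ContDiff ℝ ∞ G := contDiff_curry_of_contDiff hΘ' continuous_subtype_val (fun X p => hGdef X p)
  have hG0 : ∀ X, X ∉ C_X → G X = 0 := fun X hX => by
    ext p; rw [hGdef]; exact h0' _ X hX
  obtain ⟨Mb, hMb⟩ := hEng G hG hG0 a
  refine ⟨max Mb 0 * ∏ k, ‖(Module.finBasis ℝ V₁) (u k)‖, fun z hz => ?_⟩
  have hzW : z ∈ Sθ ×ˢ O := hAW hz
  -- the word IS the `θ`-word of the slice `θ ↦ r θ • ∫ ev_q (G (κ_y θ)) dμ` at `q = z.2`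
  rw [hEq hzW, foldr_fderiv_inl_eq_foldr_slice hW a (fun k => (Module.finBasis ℝ V₁) (u k)) hfam hzW]
  have hslice : (fun θ : V₁ => r θ • ∫ y, Θ' (z.2, κ y θ) ∂μ) =
      fun θ : V₁ => r θ • ∫ y, (BoundedContinuousFunction.evalCLM ℝ (⟨z.2, hz.2⟩ : ↥K)) (G (κ y θ)) ∂μ := by
    funext θ
    simp only [BoundedContinuousFunction.evalCLM_apply, hGdef]
  have hsθ : ContDiffOn ℝ ∞ (fun θ : V₁ => r θ • ∫ y, Θ' (z.2, κ y θ) ∂μ) Sθ :=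
    hfam.comp (contDiffOn_id.prodMk contDiffOn_const) fun θ hθ => ⟨hθ, hKO hz.2⟩
  rw [show (fun θ : V₁ => (fun z : V₁ × P => r z.1 • ∫ y, Θ' (z.2, κ y z.1) ∂μ) (θ, z.2)) = fun θ : V₁ => r θ • ∫ y, Θ' (z.2, κ y θ) ∂μ from rfl,
    ← iteratedFDeriv_apply_eq_foldr_fderiv hSθ a (hsθ.of_le (by exact_mod_cast le_top)) (hS' hz.1)]
  refine (ContinuousMultilinearMap.le_opNorm _ _).trans (mul_le_mul_of_nonneg_right ?_ (Finset.prod_nonneg fun k _ => norm_nonneg _))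
  rw [hslice]
  have hℓ : ‖(BoundedContinuousFunction.evalCLM ℝ (⟨z.2, hz.2⟩ : ↥K) : (↥K →ᵇ F) →L[ℝ] F)‖ ≤ 1 :=
    ContinuousLinearMap.opNorm_le_bound _ zero_le_one fun f : ↥K →ᵇ F => by
      simpa only [BoundedContinuousFunction.evalCLM_apply, one_mul] using BoundedContinuousFunction.norm_coe_le_norm f (⟨z.2, hz.2⟩ : ↥K)
  refine (hMb z.1 hz.1 _).trans ?_
  rcases le_or_gt 0 Mb with hM | hM
  · rw [max_eq_left hM]
    exact (mul_le_mul_of_nonneg_right hℓ hM).trans_eq (one_mul Mb)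
  · rw [max_eq_right hM.le]
    exact mul_nonpos_of_nonneg_of_nonpos (norm_nonneg _) hM.le

end Head

end Literature.Analysis.Calculus

end
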